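import Summits.Ventures.CertifiedManyBodySolver.Rows.HalfFilledTLTorus

/-!
# M2 rows, part 5: finite even tori — the nearest-neighbour spin row `T{L}_C1` and the docc row `T{L}_D`

HONEST FRAMING (speedrun cell `mbsolver`, M2): first certified bounds; not a superconductivity
verdict; every number certified or labelled float.  This file contains NO numbers: it supplies the
typed home of the finite-torus spin cell `T{L}_C1` of the M2 table (`HOME/m2/M2-TABLE.md`) and the
by-name bridges filling it and the docc cell `T{L}_D` (`Rows/HalfFilledTL.lean`'s `M2.TorusDoccRow`)
from finite-torus sector certificates; a cell is filled only by a certificate-backed term of the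
named type.  Companion of `Rows/HalfFilledTLTorus.lean` (part 4: energy rows `T{L}_E`, the stated
torus sequence and its two proved edges to `L = ∞`, the kinetic row); a single torus number is never a
thermodynamic-limit number here.  Also here: the outward roundings `TorusEnergy{Lower,Upper,}Row.mono` (endpoint side goals by
`norm_num`, whatever the spelling of the two rationals; the substrate's E1/E2 energy nodes — rational
couplings cast to `ℝ` — enter through part 4's `TorusEnergy{Lower,Upper}Row.of_rect_ratCast`).

`M2.TorusSpinNNRow L U lo hi : lo ≤ L⁻² Re⟨ψ, W_{e₁} ψ⟩ ≤ hi` for every normalised `L²`-particle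
ground state `ψ` of the `L × L` torus (`W_r = Σ_u 𝐒_u·𝐒_{u+r}`, `Observables.spinCorrSum`; the row
value `M2.torusSpinNN L ψ = Observables.spinCorr L e₁ ψ` is the `r = e₁` entry of the M3
structure-factor table), split into `TorusSpinNNLowerRow` / `TorusSpinNNUpperRow`.  On an even torus
with `L ≥ 3` and `U > 0` every nearest-neighbour bond has the same ground-state spin correlation
(translations and the point group `D₄` fix the unique ground state: `expect_fermionSpinDot_adj_eq`),
so the bond sum `Σ_x Σ_{y ∼ x} 𝐒_x·𝐒_y` of the substrate's finite-torus `spin_nn` certificates has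
expectation `4 · ⟨ψ, W_{e₁} ψ⟩` (`expect_bondSpinSum_eq`; `4L²` ordered bonds).  A SECTOR node has the
shape "`E₀(N) ≤ u` ⟹ for every unit `N`-particle `ψ` with `Hψ = E₀ψ`, `q ≤ Re⟨ψ, (λ • O) ψ⟩`"
(`N = L²` a numeral, `λ = ±1`); given the energy ceiling `u` it was issued for and an outward
rounding, such a node IS the cell's floor / ceiling: `TorusSpinNNLowerRow.of_bondSum`,
`TorusSpinNNUpperRow.of_bondSumNeg`, `TorusSpinNNRow.of_bondSum_pair` (`O` = the bond sum; even
`L ≥ 3`, `U > 0`), and `TorusDoccRow.of_sectorNodes` (`O = Σ_x n_{x↑}n_{x↓}`; any `L`, `U`).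

References: Lieb, PRL 62 (1989) 1201, Theorem 2 (unique half-filled ground state, `U > 0`, even
torus); Koma–Tasaki (1994) §1; Tasaki (2020) §2.1, §10.1; Wang et al., PRX 14 (2024) 031006 §III.
-/

noncomputable section

namespace Summit.Ventures.CertifiedManyBodySolver

open Literature.MathematicalPhysics.QuantumLattice
open Matrix HubbardWave0 Literature.Probability.LatticeModels FermionSpinMoment ThermodynamicLimit
  Filter Topology
open Literature.MathematicalPhysics.QuantumLattice.FermionTorus (ofTorusSite toTorusSite)
open Summit.HubbardSuperconductivity.ManyBodyBootstrap.Bounds (E₀ CertifiedBound nnSupport cNN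
  zero_mem_nnSupport e1_mem_nnSupport e2_mem_nnSupport)
open scoped ComplexOrder BigOperators

namespace M2

/-! ## Outward roundings of the energy rows (endpoint side goals by `norm_num`)
The substrate's energy nodes carry RATIONAL couplings cast to `ℝ` (`E₀ a b t U N =
groundEnergyAt (fermionRectTorusGraph a b) (t : ℝ) (U : ℝ) N` with `t U : ℚ`; likewise `E2.E0Lower/E0Upper`),
so both the E1 floors `sdp_lower_4x4_U*_N16_*` and the E2 rows enter through part 4's
`TorusEnergy{Lower,Upper}Row.of_rect_ratCast`; `.mono` then re-spells the endpoint as printed. -/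
/-- **Outward rounding of a floor**: a floor `q` is a floor `lo` for every `lo ≤ q` (the typer states
the cell's printed endpoint and discharges `lo ≤ q` by `norm_num`, whatever the spelling of the two
rationals). [folklore] -/
theorem TorusEnergyLowerRow.mono {L : ℕ} {U : ℝ} {q lo : ℚ} (h : TorusEnergyLowerRow L U q)
    (hlo : lo ≤ q) : TorusEnergyLowerRow L U lo :=
  ((Rat.cast_le (K := ℝ)).2 hlo).trans h

/-- **Outward rounding of a ceiling**: `q ≤ hi`. [folklore] -/
theorem TorusEnergyUpperRow.mono {L : ℕ} {U : ℝ} {q hi : ℚ} (h : TorusEnergyUpperRow L U q)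
    (hhi : q ≤ hi) : TorusEnergyUpperRow L U hi :=
  le_trans (b := ((q : ℚ) : ℝ)) h ((Rat.cast_le (K := ℝ)).2 hhi)

/-- Two-sided outward rounding. [folklore] -/
theorem TorusEnergyRow.mono {L : ℕ} {U : ℝ} {qlo qhi lo hi : ℚ} (h : TorusEnergyRow L U qlo qhi)
    (hlo : lo ≤ qlo) (hhi : qhi ≤ hi) : TorusEnergyRow L U lo hi :=
  ⟨h.1.mono hlo, h.2.mono hhi⟩

/-! ## The nearest-neighbour spin row and its symmetry reduction -/
section TorusSpin

variable {L : ℕ} [NeZero L]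

/-- **The finite-torus nearest-neighbour spin value** of a state `ψ` on the `L × L` torus:
`L⁻² Re⟨ψ, W_{e₁} ψ⟩`, `W_{e₁} = Σ_u 𝐒_u·𝐒_{u+e₁}` — the `r = e₁` entry `Observables.spinCorr L e₁ ψ`
of the structure-factor table (M3). [cite: Hirsch1985, §III] -/
def torusSpinNN (L : ℕ) [NeZero L] (ψ : Fock (Orb (FermionTorus 2 L))) : ℝ :=
  Observables.spinCorr L (Pi.single 0 1) ψ

/-- `torusSpinNN` unfolded: `(Re⟨ψ, W_{e₁}ψ⟩) / L²`. [cite: Hirsch1985, §III] -/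
theorem torusSpinNN_eq (ψ : Fock (Orb (FermionTorus 2 L))) :
    torusSpinNN L ψ = (expect (Observables.spinCorrSum L (Pi.single 0 1)) ψ).re / ((L : ℝ) ^ 2) := rfl

/-- **Finite-torus spin row** `T{L}_C1`: `lo ≤ L⁻² Re⟨ψ, W_{e₁} ψ⟩ ≤ hi` for every normalised
`L²`-particle ground state `ψ` of the `L × L` Hubbard torus at `t = 1` (shape of `TorusDoccRow`).
[cite: Hirsch1985, §III] [cite: LiebPRL1989, Theorem 2] -/
def TorusSpinNNRow (L : ℕ) [NeZero L] (U : ℝ) (lo hi : ℚ) : Prop :=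
  ∀ ψ : Fock (Orb (FermionTorus 2 L)),
    IsGroundState (hamiltonian (fermionTorusGraph 2 L) 1 U) (L ^ 2) ψ → star ψ ⬝ᵥ ψ = 1 →
      ((lo : ℚ) : ℝ) ≤ torusSpinNN L ψ ∧ torusSpinNN L ψ ≤ ((hi : ℚ) : ℝ)

/-- One-sided: the floor `lo ≤ L⁻² Re⟨ψ, W_{e₁} ψ⟩` on ground states. [cite: Hirsch1985, §III] -/
def TorusSpinNNLowerRow (L : ℕ) [NeZero L] (U : ℝ) (lo : ℚ) : Prop :=
  ∀ ψ : Fock (Orb (FermionTorus 2 L)),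
    IsGroundState (hamiltonian (fermionTorusGraph 2 L) 1 U) (L ^ 2) ψ → star ψ ⬝ᵥ ψ = 1 →
      ((lo : ℚ) : ℝ) ≤ torusSpinNN L ψ

/-- One-sided: the ceiling `L⁻² Re⟨ψ, W_{e₁} ψ⟩ ≤ hi` on ground states. [cite: Hirsch1985, §III] -/
def TorusSpinNNUpperRow (L : ℕ) [NeZero L] (U : ℝ) (hi : ℚ) : Prop :=
  ∀ ψ : Fock (Orb (FermionTorus 2 L)),
    IsGroundState (hamiltonian (fermionTorusGraph 2 L) 1 U) (L ^ 2) ψ → star ψ ⬝ᵥ ψ = 1 →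
      torusSpinNN L ψ ≤ ((hi : ℚ) : ℝ)

/-- Floor and ceiling make the row. [cite: Hirsch1985, §III] -/
theorem TorusSpinNNRow.of_lower_upper {U : ℝ} {lo hi : ℚ} (hlo : TorusSpinNNLowerRow L U lo)
    (hhi : TorusSpinNNUpperRow L U hi) : TorusSpinNNRow L U lo hi :=
  fun ψ hψ h1 => ⟨hlo ψ hψ h1, hhi ψ hψ h1⟩

/-- The row splits into floor and ceiling. [cite: Hirsch1985, §III] -/
theorem torusSpinNNRow_iff {U : ℝ} {lo hi : ℚ} :
    TorusSpinNNRow L U lo hi ↔ TorusSpinNNLowerRow L U lo ∧ TorusSpinNNUpperRow L U hi :=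
  ⟨fun h => ⟨fun ψ hψ h1 => (h ψ hψ h1).1, fun ψ hψ h1 => (h ψ hψ h1).2⟩,
    fun h => TorusSpinNNRow.of_lower_upper h.1 h.2⟩

omit [NeZero L] in
/-- `d4Site (r 1)` is the quarter turn `rotSite`. [cite: Scalapino1995, §2 (square-lattice point group)] -/
private theorem d4Site_r_one' (x : TorusSite 2 L) : d4Site (DihedralGroup.r 1) x = rotSite x := rfl

omit [NeZero L] in
/-- The quarter turn fixes the origin. [cite: Scalapino1995, §2 (square-lattice point group)] -/
private theorem rotSite_zero' : rotSite (0 : TorusSite 2 L) = 0 := by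
  funext k; fin_cases k <;> simp [rotSite]

omit [NeZero L] in
/-- The quarter turn maps `e₁ ↦ e₂`. [cite: Scalapino1995, §2 (square-lattice point group)] -/
private theorem rotSite_e1' : rotSite (Pi.single 0 1 : TorusSite 2 L) = Pi.single 1 1 := by
  funext k; fin_cases k <;> simp [rotSite]

omit [NeZero L] in
/-- The quarter turn maps `e₂ ↦ -e₁`. [cite: Scalapino1995, §2 (square-lattice point group)] -/
private theorem rotSite_e2' : rotSite (Pi.single 1 1 : TorusSite 2 L) = -Pi.single 0 1 := by
  funext k; fin_cases k <;> simp [rotSite]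

omit [NeZero L] in
/-- The quarter turn maps `-e₁ ↦ -e₂`. [cite: Scalapino1995, §2 (square-lattice point group)] -/
private theorem rotSite_neg_e1' : rotSite (-Pi.single 0 1 : TorusSite 2 L) = -Pi.single 1 1 := by
  funext k; fin_cases k <;> simp [rotSite]

/-- **Ground-state spin correlations are `D₄`-covariant at the origin**:
`⟨ψ, 𝐒_0·𝐒_{rot u} ψ⟩ = ⟨ψ, 𝐒_0·𝐒_u ψ⟩` for the half-filled ground state of an even torus (`U > 0`).
[cite: LiebPRL1989, Theorem 2] [cite: LiebLossMccann1993, p. 894 (remark after the Theorem)] -/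
theorem expect_fermionSpinDot_zero_rotSite (hL : Even L) {U : ℝ} (hU : 0 < U)
    {ψ : Fock (Orb (FermionTorus 2 L))}
    (hψ : IsGroundState (hamiltonian (fermionTorusGraph 2 L) 1 U) (L ^ 2) ψ) (u : TorusSite 2 L) :
    expect (fermionSpinDot (ofTorusSite (0 : TorusSite 2 L)) (ofTorusSite (rotSite u))) ψ =
      expect (fermionSpinDot (ofTorusSite (0 : TorusSite 2 L)) (ofTorusSite u)) ψ := by
  have h := hubbardTorus_expect_relabel_d4Perm_eq hL one_ne_zero hU hψ (DihedralGroup.r 1)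
    (fermionSpinDot (ofTorusSite (0 : TorusSite 2 L)) (ofTorusSite u))
  rw [Observables.relabel_d4Perm_fermionSpinDot, d4Site_r_one', d4Site_r_one', rotSite_zero'] at h
  exact h

/-- **Ground-state spin correlations are translation-covariant**:
`⟨ψ, 𝐒_x·𝐒_y ψ⟩ = ⟨ψ, 𝐒_0·𝐒_{y−x} ψ⟩` (torus coordinates) for the half-filled ground state of an even
torus (`U > 0`). [cite: LiebPRL1989, Theorem 2] [cite: LiebLossMccann1993, p. 894 (remark after the Theorem)] -/
theorem expect_fermionSpinDot_eq_zero_sub (hL : Even L) {U : ℝ} (hU : 0 < U)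
    {ψ : Fock (Orb (FermionTorus 2 L))}
    (hψ : IsGroundState (hamiltonian (fermionTorusGraph 2 L) 1 U) (L ^ 2) ψ) (x y : TorusSite 2 L) :
    expect (fermionSpinDot (ofTorusSite x) (ofTorusSite y)) ψ =
      expect (fermionSpinDot (ofTorusSite (0 : TorusSite 2 L)) (ofTorusSite (y - x))) ψ := by
  have h := hubbardTorus_expect_relabel_translate_eq hL one_ne_zero hU hψ (-x)
    (fermionSpinDot (ofTorusSite x) (ofTorusSite y))
  rw [Observables.relabel_translate_fermionSpinDot, add_neg_cancel, ← sub_eq_add_neg] at h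
  exact h.symm

/-- **Every nearest-neighbour bond of an even torus (`L ≥ 3`, `U > 0`) has the same ground-state
spin correlation**: `⟨ψ, 𝐒_x·𝐒_y ψ⟩ = ⟨ψ, 𝐒_0·𝐒_{e₁} ψ⟩` for adjacent `x, y` (translate `x` to the
origin; the four neighbours `±e₁, ±e₂` of the origin are one `D₄`-orbit).
[cite: LiebPRL1989, Theorem 2] [cite: LiebLossMccann1993, p. 894 (remark after the Theorem)] -/
theorem expect_fermionSpinDot_adj_eq (hL : Even L) {U : ℝ} (hU : 0 < U)
    {ψ : Fock (Orb (FermionTorus 2 L))}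
    (hψ : IsGroundState (hamiltonian (fermionTorusGraph 2 L) 1 U) (L ^ 2) ψ)
    {x y : FermionTorus 2 L} (hxy : (fermionTorusGraph 2 L).Adj x y) :
    expect (fermionSpinDot x y) ψ =
      expect (fermionSpinDot (ofTorusSite (0 : TorusSite 2 L))
        (ofTorusSite (Pi.single 0 1 : TorusSite 2 L))) ψ := by
  rw [← FermionTorus.ofTorusSite_toTorusSite x, ← FermionTorus.ofTorusSite_toTorusSite y,
    expect_fermionSpinDot_eq_zero_sub hL hU hψ]
  rw [fermionTorusGraph_adj, torusGraph_adj_iff] at hxy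
  obtain ⟨-, ⟨i, hi⟩ | ⟨i, hi⟩⟩ := hxy
  · have hd : toTorusSite y - toTorusSite x = Pi.single i 1 := by rw [hi, add_sub_cancel_left]
    rw [hd]
    fin_cases i
    · rfl
    · -- `e₂ = rot e₁`
      have h1 := expect_fermionSpinDot_zero_rotSite hL hU hψ (Pi.single 0 1 : TorusSite 2 L)
      rw [rotSite_e1'] at h1
      exact h1
  · have hd : toTorusSite y - toTorusSite x = -Pi.single i 1 := by rw [hi, sub_add_cancel_left]
    rw [hd]
    fin_cases i
    · -- `-e₁ = rot (rot e₁)`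
      have h1 := expect_fermionSpinDot_zero_rotSite hL hU hψ (Pi.single 1 1 : TorusSite 2 L)
      have h2 := expect_fermionSpinDot_zero_rotSite hL hU hψ (Pi.single 0 1 : TorusSite 2 L)
      rw [rotSite_e2'] at h1
      rw [rotSite_e1'] at h2
      exact h1.trans h2
    · -- `-e₂ = rot (-e₁) = rot (rot (rot e₁))`
      have h1 := expect_fermionSpinDot_zero_rotSite hL hU hψ (-Pi.single 0 1 : TorusSite 2 L)
      have h2 := expect_fermionSpinDot_zero_rotSite hL hU hψ (Pi.single 1 1 : TorusSite 2 L)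
      have h3 := expect_fermionSpinDot_zero_rotSite hL hU hψ (Pi.single 0 1 : TorusSite 2 L)
      rw [rotSite_neg_e1'] at h1
      rw [rotSite_e2'] at h2
      rw [rotSite_e1'] at h3
      exact h1.trans (h2.trans h3)

/-- **The bond-summed spin operator has expectation `4 · ⟨ψ, W_{e₁} ψ⟩`** in the half-filled ground
state of an even `L × L` torus, `L ≥ 3`, `U > 0`: `Σ_x Σ_{y ∼ x} ⟨𝐒_x·𝐒_y⟩ = 4L² · ⟨𝐒_0·𝐒_{e₁}⟩ =
4 ⟨W_{e₁}⟩` (every site has exactly four neighbours, `card_filter_fermionTorusGraph_adj`; every bond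
and every summand of `W_{e₁}` carries the common value `expect_fermionSpinDot_adj_eq`).  The left side
is the objective of the substrate's finite-torus `spin_nn` certificates.
[cite: LiebPRL1989, Theorem 2] [cite: Hirsch1985, §III] -/
theorem expect_bondSpinSum_eq (hL3 : 3 ≤ L) (hL : Even L) {U : ℝ} (hU : 0 < U)
    {ψ : Fock (Orb (FermionTorus 2 L))}
    (hψ : IsGroundState (hamiltonian (fermionTorusGraph 2 L) 1 U) (L ^ 2) ψ) :
    expect (∑ x : FermionTorus 2 L, ∑ y : FermionTorus 2 L,
        if (fermionTorusGraph 2 L).Adj x y then fermionSpinDot x y else 0) ψ =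
      4 * expect (Observables.spinCorrSum L (Pi.single 0 1)) ψ := by
  set c := expect (fermionSpinDot (ofTorusSite (0 : TorusSite 2 L))
    (ofTorusSite (Pi.single 0 1 : TorusSite 2 L))) ψ with hc
  -- every bond term is `c`; each site has four neighbours
  have hbond : expect (∑ x : FermionTorus 2 L, ∑ y : FermionTorus 2 L,
      if (fermionTorusGraph 2 L).Adj x y then fermionSpinDot x y else 0) ψ =
        (L : ℂ) ^ 2 * (4 * c) := by
    rw [expect_sum]
    have hx : ∀ x : FermionTorus 2 L, expect (∑ y : FermionTorus 2 L,
        if (fermionTorusGraph 2 L).Adj x y then fermionSpinDot x y else 0) ψ = 4 * c := by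
      intro x
      rw [expect_sum]
      have hy : ∀ y : FermionTorus 2 L,
          expect (if (fermionTorusGraph 2 L).Adj x y then fermionSpinDot x y else 0) ψ =
            if (fermionTorusGraph 2 L).Adj x y then c else 0 := by
        intro y
        split_ifs with hxy
        · exact expect_fermionSpinDot_adj_eq hL hU hψ hxy
        · simp [expect]
      simp_rw [hy]
      rw [Finset.sum_ite, Finset.sum_const_zero, add_zero, Finset.sum_const,
        card_filter_fermionTorusGraph_adj hL3, nsmul_eq_mul, Nat.cast_ofNat]
    simp_rw [hx]
    rw [Finset.sum_const, Finset.card_univ, LangerMattis.card_fermionTorus_eq, nsmul_eq_mul,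
      Nat.cast_pow]
  -- every summand of `W_{e₁}` is `c`
  have hW : expect (Observables.spinCorrSum L (Pi.single 0 1)) ψ = (L : ℂ) ^ 2 * c := by
    unfold Observables.spinCorrSum
    rw [expect_sum]
    have hu : ∀ u : TorusSite 2 L,
        expect (fermionSpinDot (ofTorusSite u) (ofTorusSite (u + Pi.single 0 1))) ψ = c := by
      intro u
      rw [expect_fermionSpinDot_eq_zero_sub hL hU hψ, add_sub_cancel_left]
    simp_rw [hu]
    rw [Finset.sum_const, Finset.card_univ, _root_.Literature.Probability.LatticeModels.card_torusSite 2 L,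
      nsmul_eq_mul, Nat.cast_pow]
  rw [hbond, hW]
  ring

/-- **A sector-certificate floor on the bond sum gives the row's floor.**  The substrate's
finite-torus `spin_nn` nodes (`λ = 1`) have the shape "`E₀(N) ≤ u` ⟹ for every unit `N`-particle
`ψ` with `Hψ = E₀ψ`, `q ≤ Re⟨ψ, (1 • Σ_x Σ_{y∼x} 𝐒_x·𝐒_y) ψ⟩`" with `N = L²` a numeral; given the
energy ceiling `T{L}_E.hi = u` they were issued for, such a node gives `T{L}_C1.lo = lo` for every
rational `lo` with `lo · 4L² ≤ q` (even `L ≥ 3`, `U > 0`; `4L²` ordered nearest-neighbour pairs).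
[cite: WangEtAl2024, §III] [cite: LiebPRL1989, Theorem 2] -/
theorem TorusSpinNNLowerRow.of_bondSum (hL3 : 3 ≤ L) (hL : Even L) {U : ℝ} (hU : 0 < U) {N : ℕ}
    (hN : L ^ 2 = N) {u q lo : ℚ} (hE : TorusEnergyUpperRow L U u)
    (h : groundEnergyAt (fermionTorusGraph 2 L) 1 U N ≤ ((u : ℚ) : ℝ) →
      ∀ ψ : Fock (Orb (FermionTorus 2 L)), IsNParticle N ψ → star ψ ⬝ᵥ ψ = 1 →
        hamiltonian (fermionTorusGraph 2 L) 1 U *ᵥ ψ =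
          ((groundEnergyAt (fermionTorusGraph 2 L) 1 U N : ℝ) : ℂ) • ψ →
        ((q : ℚ) : ℝ) ≤ (star ψ ⬝ᵥ ((((1 : ℚ) : ℂ)) • (∑ x : FermionTorus 2 L, ∑ y : FermionTorus 2 L,
          if (fermionTorusGraph 2 L).Adj x y then fermionSpinDot x y else 0)) *ᵥ ψ).re)
    (hlo : lo * (4 * (L : ℚ) ^ 2) ≤ q) :
    TorusSpinNNLowerRow L U lo := by
  subst hN
  intro ψ hψ h1
  have hq := h hE ψ hψ.1 h1 hψ.2.2
  rw [← expect, expect_smul, Rat.cast_one, one_mul, expect_bondSpinSum_eq hL3 hL hU hψ] at hq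
  have hre : (4 * expect (Observables.spinCorrSum L (Pi.single 0 1)) ψ).re =
      4 * (expect (Observables.spinCorrSum L (Pi.single 0 1)) ψ).re := by
    simp [Complex.mul_re]
  rw [hre] at hq
  have hlo' := (Rat.cast_le (K := ℝ)).2 hlo
  push_cast at hlo'
  have hL0 : (0 : ℝ) < (L : ℝ) ^ 2 := by have := NeZero.pos L; positivity
  rw [torusSpinNN_eq, le_div_iff₀ hL0]
  linarith

/-- **A sector-certificate floor on the NEGATED bond sum gives the row's ceiling** (`λ = −1` nodes):
`q ≤ Re⟨ψ, (−1 • Σ_x Σ_{y∼x} 𝐒_x·𝐒_y) ψ⟩` on the unit `N = L²`-particle ground vectors, given the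
energy ceiling `u`, gives `T{L}_C1.hi = hi` for every rational `hi` with `−q ≤ hi · 4L²`.
[cite: WangEtAl2024, §III] [cite: LiebPRL1989, Theorem 2] -/
theorem TorusSpinNNUpperRow.of_bondSumNeg (hL3 : 3 ≤ L) (hL : Even L) {U : ℝ} (hU : 0 < U) {N : ℕ}
    (hN : L ^ 2 = N) {u q hi : ℚ} (hE : TorusEnergyUpperRow L U u)
    (h : groundEnergyAt (fermionTorusGraph 2 L) 1 U N ≤ ((u : ℚ) : ℝ) →
      ∀ ψ : Fock (Orb (FermionTorus 2 L)), IsNParticle N ψ → star ψ ⬝ᵥ ψ = 1 →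
        hamiltonian (fermionTorusGraph 2 L) 1 U *ᵥ ψ =
          ((groundEnergyAt (fermionTorusGraph 2 L) 1 U N : ℝ) : ℂ) • ψ →
        ((q : ℚ) : ℝ) ≤ (star ψ ⬝ᵥ ((((-1 : ℚ) : ℂ)) • (∑ x : FermionTorus 2 L, ∑ y : FermionTorus 2 L,
          if (fermionTorusGraph 2 L).Adj x y then fermionSpinDot x y else 0)) *ᵥ ψ).re)
    (hhi : -q ≤ hi * (4 * (L : ℚ) ^ 2)) :
    TorusSpinNNUpperRow L U hi := by
  subst hN
  intro ψ hψ h1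
  have hq := h hE ψ hψ.1 h1 hψ.2.2
  rw [← expect, expect_smul, expect_bondSpinSum_eq hL3 hL hU hψ] at hq
  have hre : ((((-1 : ℚ) : ℂ)) * (4 * expect (Observables.spinCorrSum L (Pi.single 0 1)) ψ)).re =
      -(4 * (expect (Observables.spinCorrSum L (Pi.single 0 1)) ψ).re) := by
    simp [Complex.mul_re]
  rw [hre] at hq
  have hhi' := (Rat.cast_le (K := ℝ)).2 hhi
  push_cast at hhi'
  have hL0 : (0 : ℝ) < (L : ℝ) ^ 2 := by have := NeZero.pos L; positivity
  rw [torusSpinNN_eq, div_le_iff₀ hL0]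
  linarith

/-- **One call for the cell `T{L}_C1`**: the energy ceiling `u`, the two sector nodes issued for it,
and the two outward roundings `lo · 4L² ≤ q_lo`, `−q_up ≤ hi · 4L²`.
[cite: WangEtAl2024, §III] [cite: LiebPRL1989, Theorem 2] -/
theorem TorusSpinNNRow.of_bondSum_pair (hL3 : 3 ≤ L) (hL : Even L) {U : ℝ} (hU : 0 < U) {N : ℕ}
    (hN : L ^ 2 = N) {u qlo qup lo hi : ℚ} (hE : TorusEnergyUpperRow L U u)
    (hclo : groundEnergyAt (fermionTorusGraph 2 L) 1 U N ≤ ((u : ℚ) : ℝ) →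
      ∀ ψ : Fock (Orb (FermionTorus 2 L)), IsNParticle N ψ → star ψ ⬝ᵥ ψ = 1 →
        hamiltonian (fermionTorusGraph 2 L) 1 U *ᵥ ψ =
          ((groundEnergyAt (fermionTorusGraph 2 L) 1 U N : ℝ) : ℂ) • ψ →
        ((qlo : ℚ) : ℝ) ≤ (star ψ ⬝ᵥ ((((1 : ℚ) : ℂ)) • (∑ x : FermionTorus 2 L, ∑ y : FermionTorus 2 L,
          if (fermionTorusGraph 2 L).Adj x y then fermionSpinDot x y else 0)) *ᵥ ψ).re)
    (hcup : groundEnergyAt (fermionTorusGraph 2 L) 1 U N ≤ ((u : ℚ) : ℝ) →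
      ∀ ψ : Fock (Orb (FermionTorus 2 L)), IsNParticle N ψ → star ψ ⬝ᵥ ψ = 1 →
        hamiltonian (fermionTorusGraph 2 L) 1 U *ᵥ ψ =
          ((groundEnergyAt (fermionTorusGraph 2 L) 1 U N : ℝ) : ℂ) • ψ →
        ((qup : ℚ) : ℝ) ≤ (star ψ ⬝ᵥ ((((-1 : ℚ) : ℂ)) • (∑ x : FermionTorus 2 L, ∑ y : FermionTorus 2 L,
          if (fermionTorusGraph 2 L).Adj x y then fermionSpinDot x y else 0)) *ᵥ ψ).re)
    (hlo : lo * (4 * (L : ℚ) ^ 2) ≤ qlo) (hhi : -qup ≤ hi * (4 * (L : ℚ) ^ 2)) :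
    TorusSpinNNRow L U lo hi :=
  TorusSpinNNRow.of_lower_upper (TorusSpinNNLowerRow.of_bondSum hL3 hL hU hN hE hclo hlo)
    (TorusSpinNNUpperRow.of_bondSumNeg hL3 hL hU hN hE hcup hhi)

/-- **The docc twin, for the cell `T{L}_D`** (`Rows/HalfFilledTL.lean`'s `TorusDoccRow`): the sector
nodes `q_lo ≤ Re⟨ψ, (1 • Σ_x n_{x↑}n_{x↓}) ψ⟩` and `q_up ≤ Re⟨ψ, (−1 • Σ_x n_{x↑}n_{x↓}) ψ⟩` on the unit
`N = L²`-particle ground vectors, with the energy ceiling `u` they were issued for and outward roundings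
`lo · L² ≤ q_lo`, `−q_up ≤ hi · L²`, give `TorusDoccRow L U lo hi` (any `L`, any `U`: no symmetry used).
[cite: WangEtAl2024, §III] [cite: KomaTasaki1994, §1] -/
theorem TorusDoccRow.of_sectorNodes {U : ℝ} {N : ℕ} (hN : L ^ 2 = N) {u qlo qup lo hi : ℚ}
    (hE : TorusEnergyUpperRow L U u)
    (hclo : groundEnergyAt (fermionTorusGraph 2 L) 1 U N ≤ ((u : ℚ) : ℝ) →
      ∀ ψ : Fock (Orb (FermionTorus 2 L)), IsNParticle N ψ → star ψ ⬝ᵥ ψ = 1 →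
        hamiltonian (fermionTorusGraph 2 L) 1 U *ᵥ ψ =
          ((groundEnergyAt (fermionTorusGraph 2 L) 1 U N : ℝ) : ℂ) • ψ →
        ((qlo : ℚ) : ℝ) ≤ (star ψ ⬝ᵥ ((((1 : ℚ) : ℂ)) •
          (∑ x : FermionTorus 2 L, numberOp x 0 * numberOp x 1)) *ᵥ ψ).re)
    (hcup : groundEnergyAt (fermionTorusGraph 2 L) 1 U N ≤ ((u : ℚ) : ℝ) →
      ∀ ψ : Fock (Orb (FermionTorus 2 L)), IsNParticle N ψ → star ψ ⬝ᵥ ψ = 1 →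
        hamiltonian (fermionTorusGraph 2 L) 1 U *ᵥ ψ =
          ((groundEnergyAt (fermionTorusGraph 2 L) 1 U N : ℝ) : ℂ) • ψ →
        ((qup : ℚ) : ℝ) ≤ (star ψ ⬝ᵥ ((((-1 : ℚ) : ℂ)) •
          (∑ x : FermionTorus 2 L, numberOp x 0 * numberOp x 1)) *ᵥ ψ).re)
    (hlo : lo * (L : ℚ) ^ 2 ≤ qlo) (hhi : -qup ≤ hi * (L : ℚ) ^ 2) :
    TorusDoccRow L U lo hi := by
  subst hN
  intro ψ hψ h1
  have hq1 := hclo hE ψ hψ.1 h1 hψ.2.2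
  have hq2 := hcup hE ψ hψ.1 h1 hψ.2.2
  rw [← expect, expect_smul, Rat.cast_one, one_mul] at hq1
  rw [← expect, expect_smul] at hq2
  have hre : ((((-1 : ℚ) : ℂ)) * expect (∑ x : FermionTorus 2 L, numberOp x 0 * numberOp x 1) ψ).re =
      -(expect (∑ x : FermionTorus 2 L, numberOp x 0 * numberOp x 1) ψ).re := by
    simp
  rw [hre] at hq2
  have hlo' := (Rat.cast_le (K := ℝ)).2 hlo
  have hhi' := (Rat.cast_le (K := ℝ)).2 hhi
  push_cast at hlo' hhi'
  have hL0 : (0 : ℝ) < (L : ℝ) ^ 2 := by have := NeZero.pos L; positivity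
  unfold doccDensity
  rw [le_div_iff₀ hL0, div_le_iff₀ hL0]
  exact ⟨by linarith, by linarith⟩

end TorusSpin

end M2

end Summit.Ventures.CertifiedManyBodySolver

end
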